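import Summits.RiemannHypothesis.RiemannHypothesis.Theses.SpectralTrace
import HarnessLib

/-!
# Crux `SpectralThesis` (stmt-RiemannHypothesis-0187), line `Sketch` — stub `stub_fixedPoint`

Banach's fixed point theorem for `T f = q ∗ fract(M + q ∗ f)` on the closed ball of radius `Q₀`
of `ℝ →ᵇ ℝ`. First the calculus of the smear `S h (u) = ∫ k(u - r) h(r) dr` of a bounded
measurable `h` against a continuous `O(1/(1+t²))` kernel (sup bound `‖k‖₁ B`, continuity,
`(S h)' = S_{k'} h` by dominated convergence with the local majorant `3KB/(1+(u₀-r)²)` on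
`|u - u₀| < 1`), then Banach on the ball, the numerics `Lip T ≤ 1/2`, and the assembly.
-/

noncomputable section

set_option linter.dupNamespace false

open Set MeasureTheory Filter
open scoped Real Topology NNReal BoundedContinuousFunction

namespace Summit.RiemannHypothesis.RiemannHypothesis.Theorems.SpectralThesis.Sketch

namespace FixedPoint

/-- A function with an `O(1/(1+t²))` bound by a continuous majorant is integrable. [folklore] -/
theorem integrable_of_decay {k : ℝ → ℝ} (hk : Continuous k) {K : ℝ}
    (hkb : ∀ t, |k t| ≤ K / (1 + t ^ 2)) : Integrable k := by
  refine Integrable.mono' (integrable_inv_one_add_sq.const_mul K) hk.aestronglyMeasurable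
    (Eventually.of_forall fun t => ?_)
  rw [Real.norm_eq_abs]
  simpa [div_eq_mul_inv] using hkb t

/-- The constant in a decay bound `|k t| ≤ K/(1+t²)` is nonnegative. [folklore] -/
theorem decay_const_nonneg {k : ℝ → ℝ} {K : ℝ} (hkb : ∀ t, |k t| ≤ K / (1 + t ^ 2)) : 0 ≤ K := by
  have h := hkb 0
  simp only [ne_eq, OfNat.ofNat_ne_zero, not_false_eq_true, zero_pow, add_zero, div_one] at h
  exact (abs_nonneg _).trans h

/-- A bound `|h r| ≤ B` forces `0 ≤ B`. [folklore] -/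
theorem bound_nonneg {h : ℝ → ℝ} {B : ℝ} (hB : ∀ r, |h r| ≤ B) : 0 ≤ B :=
  (abs_nonneg _).trans (hB 0)

/-- Local majorant: for `|v - u| < 1`, `K/(1+(v-r)²) ≤ 3K/(1+(u-r)²)`. [folklore] -/
theorem decay_shift_le {K : ℝ} (hK : 0 ≤ K) {u v : ℝ} (hv : v ∈ Metric.ball u 1) (r : ℝ) :
    K / (1 + (v - r) ^ 2) ≤ 3 * K * (1 + (u - r) ^ 2)⁻¹ := by
  rw [Metric.mem_ball, Real.dist_eq] at hv
  have h1 : (0 : ℝ) < 1 + (v - r) ^ 2 := by positivity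
  have h2 : (0 : ℝ) < 1 + (u - r) ^ 2 := by positivity
  rw [← div_eq_mul_inv, div_le_div_iff₀ h1 h2]
  have hvu : (v - u) ^ 2 ≤ 1 := by have h := abs_lt.1 hv; nlinarith
  have hkey : 1 + (u - r) ^ 2 ≤ 3 * (1 + (v - r) ^ 2) := by
    nlinarith [sq_nonneg ((u - v) - (v - r)), sq_nonneg (v - r)]
  calc K * (1 + (u - r) ^ 2) ≤ K * (3 * (1 + (v - r) ^ 2)) := mul_le_mul_of_nonneg_left hkey hK
    _ = 3 * K * (1 + (v - r) ^ 2) := by ring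

/-- The local majorant `3K(1+(u-r)²)⁻¹ B` is integrable in `r`. [folklore] -/
theorem integrable_majorant (K B u : ℝ) :
    Integrable fun r : ℝ => 3 * K * (1 + (u - r) ^ 2)⁻¹ * B :=
  ((integrable_inv_one_add_sq.comp_sub_left u).const_mul (3 * K)).mul_const B

/-- Measurability of the integrand of the smear. [folklore] -/
theorem aestronglyMeasurable_shift_mul {k : ℝ → ℝ} (hk : Continuous k) {h : ℝ → ℝ}
    (hh : AEStronglyMeasurable h) (v : ℝ) :
    AEStronglyMeasurable (fun r => k (v - r) * h r) := by
  have h1 : Continuous fun r => k (v - r) := by fun_prop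
  exact h1.aestronglyMeasurable.mul hh

/-- The shifted kernel `r ↦ k(u - r)` is integrable. [folklore] -/
theorem integrable_shift {k : ℝ → ℝ} (hk : Continuous k) {K : ℝ}
    (hkb : ∀ t, |k t| ≤ K / (1 + t ^ 2)) (u : ℝ) : Integrable fun r => k (u - r) :=
  (integrable_of_decay hk hkb).comp_sub_left u

/-- The integrand `r ↦ k(u - r) h(r)` of the smear is integrable for bounded measurable `h`.
[folklore] -/
theorem integrable_shift_mul {k : ℝ → ℝ} (hk : Continuous k) {K : ℝ}
    (hkb : ∀ t, |k t| ≤ K / (1 + t ^ 2)) {h : ℝ → ℝ} (hh : AEStronglyMeasurable h) {B : ℝ}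
    (hB : ∀ r, |h r| ≤ B) (u : ℝ) : Integrable fun r => k (u - r) * h r := by
  refine ((integrable_shift hk hkb u).norm.mul_const B).mono'
    (aestronglyMeasurable_shift_mul hk hh u) (Eventually.of_forall fun r => ?_)
  simp only [norm_mul, Real.norm_eq_abs]
  exact mul_le_mul_of_nonneg_left (hB r) (abs_nonneg _)

/-- `|∫ k(u - r) h(r) dr| ≤ ‖k‖₁ · B` for `|h| ≤ B`. [folklore] -/
theorem abs_integral_shift_mul_le {k : ℝ → ℝ} (hk : Continuous k) {K : ℝ}
    (hkb : ∀ t, |k t| ≤ K / (1 + t ^ 2)) {h : ℝ → ℝ} {B : ℝ} (hB : ∀ r, |h r| ≤ B) (u : ℝ) :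
    |∫ r, k (u - r) * h r| ≤ (∫ t, |k t|) * B := by
  have hi : Integrable fun r => k (u - r) := integrable_shift hk hkb u
  calc |∫ r, k (u - r) * h r| ≤ ∫ r, |k (u - r) * h r| := abs_integral_le_integral_abs
    _ ≤ ∫ r, |k (u - r)| * B := by
        refine integral_mono_of_nonneg (Eventually.of_forall fun r => abs_nonneg _)
          (hi.abs.mul_const B) (Eventually.of_forall fun r => ?_)
        simp only [abs_mul]
        exact mul_le_mul_of_nonneg_left (hB r) (abs_nonneg _)
    _ = (∫ r, |k (u - r)|) * B := integral_mul_const B _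
    _ = (∫ t, |k t|) * B := by
        congr 1
        exact integral_sub_left_eq_self (fun t => |k t|) volume u

/-- Differentiation under the integral sign for the smear: if `k' = dk` and `k`, `dk` are
`O(1/(1+t²))`, then `(∫ k(· - r) h(r) dr)' (u) = ∫ dk(u - r) h(r) dr`. [folklore] -/
theorem hasDerivAt_integral_shift_mul {k dk : ℝ → ℝ} (hk : ∀ t, HasDerivAt k (dk t) t)
    (hdk : Continuous dk) {K : ℝ} (hkb : ∀ t, |k t| ≤ K / (1 + t ^ 2))
    (hdkb : ∀ t, |dk t| ≤ K / (1 + t ^ 2)) {h : ℝ → ℝ} (hh : AEStronglyMeasurable h) {B : ℝ}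
    (hB : ∀ r, |h r| ≤ B) (u : ℝ) :
    HasDerivAt (fun v => ∫ r, k (v - r) * h r) (∫ r, dk (u - r) * h r) u := by
  have hkc : Continuous k := continuous_iff_continuousAt.2 fun t => (hk t).continuousAt
  have hK : 0 ≤ K := decay_const_nonneg hkb
  refine (hasDerivAt_integral_of_dominated_loc_of_deriv_le (𝕜 := ℝ) (μ := volume)
    (F := fun v r => k (v - r) * h r) (F' := fun v r => dk (v - r) * h r) (x₀ := u)
    (s := Metric.ball u 1) (bound := fun r => 3 * K * (1 + (u - r) ^ 2)⁻¹ * B)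
    (Metric.ball_mem_nhds u one_pos)
    (Eventually.of_forall fun v => aestronglyMeasurable_shift_mul hkc hh v)
    (integrable_shift_mul hkc hkb hh hB u) (aestronglyMeasurable_shift_mul hdk hh u)
    ?_ (integrable_majorant K B u) ?_).2
  · refine Eventually.of_forall fun r v hv => ?_
    rw [norm_mul, Real.norm_eq_abs, Real.norm_eq_abs]
    exact mul_le_mul ((hdkb _).trans (decay_shift_le hK hv r)) (hB r) (abs_nonneg _)
      (by positivity)
  · exact Eventually.of_forall fun r v _ => ((hk (v - r)).comp_sub_const v r).mul_const (h r)

/-- Continuity of the smear of a bounded measurable function against a continuous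
`O(1/(1+t²))` kernel (dominated convergence). [folklore] -/
theorem continuous_integral_shift_mul {k : ℝ → ℝ} (hk : Continuous k) {K : ℝ}
    (hkb : ∀ t, |k t| ≤ K / (1 + t ^ 2)) {h : ℝ → ℝ} (hh : AEStronglyMeasurable h) {B : ℝ}
    (hB : ∀ r, |h r| ≤ B) : Continuous fun u => ∫ r, k (u - r) * h r := by
  have hK : 0 ≤ K := decay_const_nonneg hkb
  refine continuous_iff_continuousAt.2 fun u => ?_
  refine continuousAt_of_dominated (F := fun v r => k (v - r) * h r)
    (bound := fun r => 3 * K * (1 + (u - r) ^ 2)⁻¹ * B)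
    (Eventually.of_forall fun v => aestronglyMeasurable_shift_mul hk hh v) ?_
    (integrable_majorant K B u) ?_
  · filter_upwards [Metric.ball_mem_nhds u one_pos] with v hv
    refine Eventually.of_forall fun r => ?_
    rw [norm_mul, Real.norm_eq_abs, Real.norm_eq_abs]
    exact mul_le_mul ((hkb _).trans (decay_shift_le hK hv r)) (hB r) (abs_nonneg _)
      (by positivity)
  · exact Eventually.of_forall fun r => (by fun_prop : Continuous fun v => k (v - r) * h r).continuousAt

/-- Linearity of the smear in `h`: difference of two smears. [folklore] -/
theorem integral_shift_mul_sub {k : ℝ → ℝ} (hk : Continuous k) {K : ℝ}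
    (hkb : ∀ t, |k t| ≤ K / (1 + t ^ 2)) {h₁ h₂ : ℝ → ℝ} (hh₁ : AEStronglyMeasurable h₁)
    (hh₂ : AEStronglyMeasurable h₂) {B₁ B₂ : ℝ} (hB₁ : ∀ r, |h₁ r| ≤ B₁) (hB₂ : ∀ r, |h₂ r| ≤ B₂)
    (u : ℝ) :
    (∫ r, k (u - r) * h₁ r) - (∫ r, k (u - r) * h₂ r) = ∫ r, k (u - r) * (h₁ r - h₂ r) := by
  rw [← integral_sub (integrable_shift_mul hk hkb hh₁ hB₁ u) (integrable_shift_mul hk hkb hh₂ hB₂ u)]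
  simp_rw [mul_sub]

/-- `|fract x| ≤ 1`. [folklore] -/
theorem abs_fract_le_one (x : ℝ) : |Int.fract x| ≤ 1 := by
  rw [Int.abs_fract]
  exact (Int.fract_lt_one x).le

/-- **Banach on the ball of `C_b(ℝ)`.** A self-map `T` of functions `ℝ → ℝ` which sends
continuous functions bounded by `R` to continuous functions bounded by `R` and halves sup
distances there has a continuous fixed point bounded by `R`. [folklore] -/
theorem exists_fixedPoint_of_contraction {R : ℝ} (hR : 0 ≤ R) (T : (ℝ → ℝ) → ℝ → ℝ)
    (hTc : ∀ f : ℝ → ℝ, Continuous f → (∀ u, |f u| ≤ R) → Continuous (T f))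
    (hTb : ∀ f : ℝ → ℝ, Continuous f → (∀ u, |f u| ≤ R) → ∀ u, |T f u| ≤ R)
    (hTl : ∀ f₁ f₂ : ℝ → ℝ, Continuous f₁ → Continuous f₂ → (∀ u, |f₁ u| ≤ R) →
      (∀ u, |f₂ u| ≤ R) → ∀ d : ℝ, 0 ≤ d → (∀ u, |f₁ u - f₂ u| ≤ d) →
        ∀ u, |T f₁ u - T f₂ u| ≤ d / 2) :
    ∃ f : ℝ → ℝ, Continuous f ∧ (∀ u, |f u| ≤ R) ∧ ∀ u, f u = T f u := by
  -- the complete metric space: the closed ball of radius `R` in `ℝ →ᵇ ℝ`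
  haveI : CompleteSpace (Metric.closedBall (0 : ℝ →ᵇ ℝ) R) :=
    Metric.isClosed_closedBall.isComplete.completeSpace_coe
  haveI : Nonempty (Metric.closedBall (0 : ℝ →ᵇ ℝ) R) := ⟨⟨0, Metric.mem_closedBall_self hR⟩⟩
  have hXb : ∀ g : Metric.closedBall (0 : ℝ →ᵇ ℝ) R, ∀ u, |(g : ℝ →ᵇ ℝ) u| ≤ R := fun g u => by
    have h1 : ‖(g : ℝ →ᵇ ℝ)‖ ≤ R := mem_closedBall_zero_iff.1 g.2
    have h2 := (g : ℝ →ᵇ ℝ).norm_coe_le_norm u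
    rw [Real.norm_eq_abs] at h2
    exact h2.trans h1
  have hXc : ∀ g : Metric.closedBall (0 : ℝ →ᵇ ℝ) R, Continuous ((g : ℝ →ᵇ ℝ) : ℝ → ℝ) :=
    fun g => (g : ℝ →ᵇ ℝ).continuous
  -- the self-map
  obtain ⟨Φ, hΦ⟩ : ∃ Φ : Metric.closedBall (0 : ℝ →ᵇ ℝ) R → Metric.closedBall (0 : ℝ →ᵇ ℝ) R,
      Φ = fun g => ⟨BoundedContinuousFunction.ofNormedAddCommGroup (T (g : ℝ →ᵇ ℝ))
        (hTc _ (hXc g) (hXb g)) R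
        (fun u => by rw [Real.norm_eq_abs]; exact hTb _ (hXc g) (hXb g) u),
        mem_closedBall_zero_iff.2
          (BoundedContinuousFunction.norm_ofNormedAddCommGroup_le _ hR _)⟩ := ⟨_, rfl⟩
  have hΦ_apply : ∀ (g : Metric.closedBall (0 : ℝ →ᵇ ℝ) R) (u : ℝ),
      ((Φ g : Metric.closedBall (0 : ℝ →ᵇ ℝ) R) : ℝ →ᵇ ℝ) u = T (g : ℝ →ᵇ ℝ) u := fun g u => by
    rw [hΦ]; rfl
  -- contraction with constant `1/2`
  have hK : ContractingWith (1 / 2) Φ := by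
    refine ⟨by norm_num, LipschitzWith.of_dist_le_mul fun g₁ g₂ => ?_⟩
    rw [Subtype.dist_eq, Subtype.dist_eq, (by norm_num : ((1 / 2 : ℝ≥0) : ℝ) = 1 / 2)]
    refine (BoundedContinuousFunction.dist_le (by positivity)).2 fun u => ?_
    rw [Real.dist_eq, hΦ_apply, hΦ_apply]
    have h := hTl _ _ (hXc g₁) (hXc g₂) (hXb g₁) (hXb g₂)
      (dist (g₁ : ℝ →ᵇ ℝ) (g₂ : ℝ →ᵇ ℝ)) dist_nonneg (fun v => ?_) u
    · linarith
    · rw [← Real.dist_eq]; exact BoundedContinuousFunction.dist_coe_le_dist v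
  -- the fixed point
  have hfix := hK.fixedPoint_isFixedPt
  refine ⟨((ContractingWith.fixedPoint Φ hK : Metric.closedBall (0 : ℝ →ᵇ ℝ) R) : ℝ →ᵇ ℝ),
    hXc _, hXb _, fun u => ?_⟩
  have h := congrArg (fun e : Metric.closedBall (0 : ℝ →ᵇ ℝ) R => (e : ℝ →ᵇ ℝ) u) hfix.eq
  simp only [hΦ_apply] at h
  exact h.symm

/-- The arithmetic of the contraction constant: with `c ≥ 4(Q₀+1)²(L+2)`, `0 ≤ Q₁, Q₂ ≤ 1`, the
sawtooth-smoothing bound with `δ₀ = Q₀ d`, `δ₁ = Q₁ d`, `δ₂ = Q₂ d` is at most `d/2`.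
[folklore] -/
theorem contraction_numerics {Q₀ Q₁ Q₂ L c d : ℝ} (hQ₀ : 0 ≤ Q₀) (hQ₁ : 0 ≤ Q₁) (hQ₁1 : Q₁ ≤ 1)
    (hQ₂1 : Q₂ ≤ 1) (hL : 0 ≤ L) (hd : 0 ≤ d)
    (hc : 4 * (Q₀ + 1) ^ 2 * (L + 2) ≤ c) :
    Q₀ * d / 2 * (Q₁ / c + Q₀ * L / c ^ 2) +
        (Q₁ * (Q₁ * d) / c ^ 2 + Q₀ * (Q₂ * d) / c ^ 2 + 2 * Q₀ * L * (Q₁ * d) / c ^ 3) / 8 ≤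
      d / 2 := by
  have hsq : Q₀ ≤ (Q₀ + 1) ^ 2 ∧ Q₀ ^ 2 ≤ (Q₀ + 1) ^ 2 ∧ (1 : ℝ) ≤ (Q₀ + 1) ^ 2 := by
    refine ⟨by nlinarith, by nlinarith, by nlinarith⟩
  have hP : 8 * (Q₀ + 1) ^ 2 ≤ c := by nlinarith
  have hc8 : (8 : ℝ) ≤ c := by nlinarith
  have hc0 : 0 < c := by linarith
  have hQc : Q₀ / c ≤ 1 / 8 := by rw [div_le_iff₀ hc0]; nlinarith
  have hQ2c : Q₀ ^ 2 / c ≤ 1 / 8 := by rw [div_le_iff₀ hc0]; nlinarith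
  have hLc : L / c ≤ 1 / 4 := by rw [div_le_iff₀ hc0]; nlinarith
  have hec : 1 / c ≤ 1 / 8 := by rw [div_le_iff₀ hc0]; nlinarith
  have ha0 : 0 ≤ Q₀ / c := by positivity
  have ha20 : 0 ≤ Q₀ ^ 2 / c := by positivity
  have hb0 : 0 ≤ L / c := by positivity
  have he0 : 0 ≤ 1 / c := by positivity
  have t1 : Q₀ / c * Q₁ ≤ 1 / 8 := by nlinarith [mul_nonneg ha0 (sub_nonneg.2 hQ₁1)]
  have t2 : Q₀ ^ 2 / c * (L / c) ≤ 1 / 32 := by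
    nlinarith [mul_le_mul hQ2c hLc hb0 (by norm_num : (0 : ℝ) ≤ 1 / 8)]
  have t3 : Q₁ ^ 2 * (1 / c) ^ 2 ≤ 1 / 64 := by
    have h1 : Q₁ ^ 2 ≤ 1 := by nlinarith
    have h2 : (1 / c) ^ 2 ≤ (1 / 8) ^ 2 := by gcongr
    nlinarith [mul_le_mul h1 h2 (by positivity) zero_le_one]
  have t4 : Q₀ / c * Q₂ * (1 / c) ≤ 1 / 64 := by
    have h1 : Q₀ / c * Q₂ ≤ 1 / 8 := by nlinarith [mul_nonneg ha0 (sub_nonneg.2 hQ₂1)]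
    nlinarith [mul_le_mul h1 hec he0 (by norm_num : (0 : ℝ) ≤ 1 / 8)]
  have t5 : Q₀ / c * (L / c) * (1 / c) * Q₁ ≤ 1 / 256 := by
    have h1 : Q₀ / c * (L / c) ≤ 1 / 32 := by
      nlinarith [mul_le_mul hQc hLc hb0 (by norm_num : (0 : ℝ) ≤ 1 / 8)]
    have h2 : Q₀ / c * (L / c) * (1 / c) ≤ 1 / 256 := by
      nlinarith [mul_le_mul h1 hec he0 (by norm_num : (0 : ℝ) ≤ 1 / 32)]
    have h3 : 0 ≤ Q₀ / c * (L / c) * (1 / c) := by positivity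
    nlinarith [mul_nonneg h3 (sub_nonneg.2 hQ₁1)]
  have hexp : Q₀ * d / 2 * (Q₁ / c + Q₀ * L / c ^ 2) +
        (Q₁ * (Q₁ * d) / c ^ 2 + Q₀ * (Q₂ * d) / c ^ 2 + 2 * Q₀ * L * (Q₁ * d) / c ^ 3) / 8 =
      d * (Q₀ / c * Q₁ / 2 + Q₀ ^ 2 / c * (L / c) / 2 + Q₁ ^ 2 * (1 / c) ^ 2 / 8 +
        Q₀ / c * Q₂ * (1 / c) / 8 + Q₀ / c * (L / c) * (1 / c) * Q₁ / 4) := by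
    field_simp
    ring
  rw [hexp]
  calc d * (Q₀ / c * Q₁ / 2 + Q₀ ^ 2 / c * (L / c) / 2 + Q₁ ^ 2 * (1 / c) ^ 2 / 8 +
        Q₀ / c * Q₂ * (1 / c) / 8 + Q₀ / c * (L / c) * (1 / c) * Q₁ / 4) ≤ d * (1 / 2) :=
        mul_le_mul_of_nonneg_left (by linarith) hd
    _ = d / 2 := by ring

end FixedPoint

open FixedPoint in
/-- **STUB · `stub_fixedPoint`** — Banach's fixed point theorem for `T f = q ∗ fract(M + q ∗ f)` on
the closed ball of radius `Q₀ = ‖q‖₁` of bounded continuous functions (sup metric), given the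
sawtooth-smoothing estimate for `q` as a hypothesis and `inf M' ≥ 8(Q₀+1)²(sup|M''| + Q₀ + 2)`
(then `Lip T ≤ 1/2`); exports the derivative facts of the smear `q ∗ f`. [folklore] -/
theorem stub_fixedPoint :
    ∀ (q dq ddq : ℝ → ℝ) (Q₀ Q₁ Q₂ Q : ℝ), (∀ t, HasDerivAt q (dq t) t) →
      (∀ t, HasDerivAt dq (ddq t) t) → Continuous ddq →
      (∀ t, |q t| ≤ Q / (1 + t ^ 2)) → (∀ t, |dq t| ≤ Q / (1 + t ^ 2)) →
      (∀ t, |ddq t| ≤ Q / (1 + t ^ 2)) →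
      (∫ t, |q t|) ≤ Q₀ → (∫ t, |dq t|) ≤ Q₁ → (∫ t, |ddq t|) ≤ Q₂ → Q₁ ≤ 1 → Q₂ ≤ 1 →
      (∀ (Φ₁ dΦ₁ ddΦ₁ Φ₂ dΦ₂ ddΦ₂ : ℝ → ℝ) (c L δ₀ δ₁ δ₂ : ℝ), 0 < c → 0 ≤ L →
        0 ≤ δ₀ → 0 ≤ δ₁ → 0 ≤ δ₂ →
        (∀ t, HasDerivAt Φ₁ (dΦ₁ t) t) → (∀ t, HasDerivAt dΦ₁ (ddΦ₁ t) t) → Continuous ddΦ₁ →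
        (∀ t, HasDerivAt Φ₂ (dΦ₂ t) t) → (∀ t, HasDerivAt dΦ₂ (ddΦ₂ t) t) → Continuous ddΦ₂ →
        (∀ t, c ≤ dΦ₁ t) → (∀ t, c ≤ dΦ₂ t) → (∀ t, |ddΦ₁ t| ≤ L) → (∀ t, |ddΦ₂ t| ≤ L) →
        (∀ t, |Φ₁ t - Φ₂ t| ≤ δ₀) → (∀ t, |dΦ₁ t - dΦ₂ t| ≤ δ₁) →
        (∀ t, |ddΦ₁ t - ddΦ₂ t| ≤ δ₂) →
        ∀ u : ℝ, |(∫ s, q (u - s) * Int.fract (Φ₁ s)) - (∫ s, q (u - s) * Int.fract (Φ₂ s))| ≤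
          δ₀ / 2 * (Q₁ / c + Q₀ * L / c ^ 2) +
            (Q₁ * δ₁ / c ^ 2 + Q₀ * δ₂ / c ^ 2 + 2 * Q₀ * L * δ₁ / c ^ 3) / 8) →
      ∀ (M ν dν : ℝ → ℝ) (c₀ L₀ : ℝ), (∀ t, HasDerivAt M (ν t) t) →
        (∀ t, HasDerivAt ν (dν t) t) → Continuous dν → (∀ t, c₀ ≤ ν t) → (∀ t, |dν t| ≤ L₀) →
        8 * (Q₀ + 1) ^ 2 * (L₀ + Q₀ + 2) ≤ c₀ →
        ∃ f : ℝ → ℝ, Continuous f ∧ (∀ u, |f u| ≤ Q₀) ∧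
          (∀ u, f u = ∫ s, q (u - s) * Int.fract (M s + ∫ r, q (s - r) * f r)) ∧
          (∀ u, HasDerivAt (fun v => ∫ r, q (v - r) * f r) (∫ r, dq (u - r) * f r) u) ∧
          (∀ u, HasDerivAt (fun v => ∫ r, dq (v - r) * f r) (∫ r, ddq (u - r) * f r) u) ∧
          Continuous (fun u => ∫ r, ddq (u - r) * f r) ∧
          (∀ u, |(∫ r, dq (u - r) * f r)| ≤ Q₁ * Q₀) ∧ (∀ u, |(∫ r, ddq (u - r) * f r)| ≤ Q₂ * Q₀) := by
  intro q dq ddq Q₀ Q₁ Q₂ Q hq hdq hddq_cont hqb hdqb hddqb hqL1 hdqL1 hddqL1 hQ₁1 hQ₂1 hsaw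
    M ν dν c₀ L₀ hM hν hdν_cont hνlow hdνb hc₀
  -- basic facts
  have hq_cont : Continuous q := continuous_iff_continuousAt.2 fun t => (hq t).continuousAt
  have hdq_cont : Continuous dq := continuous_iff_continuousAt.2 fun t => (hdq t).continuousAt
  have hM_cont : Continuous M := continuous_iff_continuousAt.2 fun t => (hM t).continuousAt
  have hQ₀ : 0 ≤ Q₀ := (integral_nonneg fun t => abs_nonneg _).trans hqL1
  have hQ₁ : 0 ≤ Q₁ := (integral_nonneg fun t => abs_nonneg _).trans hdqL1
  have hL₀ : 0 ≤ L₀ := (abs_nonneg _).trans (hdνb 0)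
  -- sup bounds of the three smears of a function bounded by `B`
  have hSq : ∀ {h : ℝ → ℝ} {B : ℝ}, (∀ r, |h r| ≤ B) → ∀ u, |∫ r, q (u - r) * h r| ≤ Q₀ * B :=
    fun hB u => (abs_integral_shift_mul_le hq_cont hqb hB u).trans
      (mul_le_mul_of_nonneg_right hqL1 (bound_nonneg hB))
  have hSdq : ∀ {h : ℝ → ℝ} {B : ℝ}, (∀ r, |h r| ≤ B) → ∀ u, |∫ r, dq (u - r) * h r| ≤ Q₁ * B :=
    fun hB u => (abs_integral_shift_mul_le hdq_cont hdqb hB u).trans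
      (mul_le_mul_of_nonneg_right hdqL1 (bound_nonneg hB))
  have hSddq : ∀ {h : ℝ → ℝ} {B : ℝ}, (∀ r, |h r| ≤ B) →
      ∀ u, |∫ r, ddq (u - r) * h r| ≤ Q₂ * B :=
    fun hB u => (abs_integral_shift_mul_le hddq_cont hddqb hB u).trans
      (mul_le_mul_of_nonneg_right hddqL1 (bound_nonneg hB))
  -- the constants fed to the sawtooth-smoothing estimate
  obtain ⟨L, hL_def⟩ : ∃ L : ℝ, L = L₀ + Q₀ := ⟨_, rfl⟩
  obtain ⟨c, hc_def⟩ : ∃ c : ℝ, c = c₀ - Q₀ := ⟨_, rfl⟩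
  have hL0 : 0 ≤ L := by rw [hL_def]; positivity
  have hc4 : 4 * (Q₀ + 1) ^ 2 * (L + 2) ≤ c := by
    have h1 : Q₀ ≤ (Q₀ + 1) ^ 2 := by nlinarith
    have h2 : 4 * (Q₀ + 1) ^ 2 * 2 ≤ 4 * (Q₀ + 1) ^ 2 * (L₀ + Q₀ + 2) :=
      mul_le_mul_of_nonneg_left (by linarith) (by positivity)
    rw [hc_def, hL_def]
    nlinarith
  have hcpos : 0 < c := by
    have h : 0 < 4 * (Q₀ + 1) ^ 2 * (L + 2) := by positivity
    linarith
  -- `T f := q ∗ fract(M + q ∗ f)` is continuous for `f` continuous with `|f| ≤ Q₀`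
  have hTc : ∀ f : ℝ → ℝ, Continuous f → (∀ u, |f u| ≤ Q₀) →
      Continuous fun u => ∫ s, q (u - s) * Int.fract (M s + ∫ r, q (s - r) * f r) := by
    intro f hf hfb
    have hΦc : Continuous fun s => M s + ∫ r, q (s - r) * f r :=
      hM_cont.add (continuous_integral_shift_mul hq_cont hqb hf.aestronglyMeasurable hfb)
    exact continuous_integral_shift_mul hq_cont hqb
      (h := fun s => Int.fract (M s + ∫ r, q (s - r) * f r))
      hΦc.measurable.fract.aestronglyMeasurable (fun s => abs_fract_le_one _)
  -- `|T f| ≤ Q₀`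
  have hTb : ∀ f : ℝ → ℝ, Continuous f → (∀ u, |f u| ≤ Q₀) →
      ∀ u, |∫ s, q (u - s) * Int.fract (M s + ∫ r, q (s - r) * f r)| ≤ Q₀ := by
    intro f _ _ u
    have h := hSq (h := fun s => Int.fract (M s + ∫ r, q (s - r) * f r))
      (fun s => abs_fract_le_one _) u
    simpa only [mul_one] using h
  -- `Lip T ≤ 1/2`: the sawtooth-smoothing estimate between the two phases `M + q ∗ fᵢ`
  have hTl : ∀ f₁ f₂ : ℝ → ℝ, Continuous f₁ → Continuous f₂ → (∀ u, |f₁ u| ≤ Q₀) →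
      (∀ u, |f₂ u| ≤ Q₀) → ∀ d : ℝ, 0 ≤ d → (∀ u, |f₁ u - f₂ u| ≤ d) →
        ∀ u, |(∫ s, q (u - s) * Int.fract (M s + ∫ r, q (s - r) * f₁ r)) -
          ∫ s, q (u - s) * Int.fract (M s + ∫ r, q (s - r) * f₂ r)| ≤ d / 2 := by
    intro f₁ f₂ hf₁ hf₂ hf₁b hf₂b d hd hdiff u
    have hf₁m : AEStronglyMeasurable f₁ := hf₁.aestronglyMeasurable
    have hf₂m : AEStronglyMeasurable f₂ := hf₂.aestronglyMeasurable
    have hdm : ∀ r, |f₁ r - f₂ r| ≤ d := hdiff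
    -- derivative lower bound and second-derivative bound of a phase
    have hlow : ∀ {g : ℝ → ℝ}, (∀ r, |g r| ≤ Q₀) → ∀ t, c ≤ ν t + ∫ r, dq (t - r) * g r := by
      intro g hg t
      have h1 := abs_le.1 ((hSdq hg t).trans (mul_le_of_le_one_left hQ₀ hQ₁1))
      have h2 := hνlow t
      rw [hc_def]
      linarith [h1.1]
    have hdd : ∀ {g : ℝ → ℝ}, (∀ r, |g r| ≤ Q₀) → ∀ t, |dν t + ∫ r, ddq (t - r) * g r| ≤ L := by
      intro g hg t
      rw [hL_def]
      exact (abs_add_le _ _).trans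
        (add_le_add (hdνb t) ((hSddq hg t).trans (mul_le_of_le_one_left hQ₀ hQ₂1)))
    have key := hsaw (fun s => M s + ∫ r, q (s - r) * f₁ r) (fun s => ν s + ∫ r, dq (s - r) * f₁ r)
      (fun s => dν s + ∫ r, ddq (s - r) * f₁ r) (fun s => M s + ∫ r, q (s - r) * f₂ r)
      (fun s => ν s + ∫ r, dq (s - r) * f₂ r) (fun s => dν s + ∫ r, ddq (s - r) * f₂ r)
      c L (Q₀ * d) (Q₁ * d) (Q₂ * d) hcpos hL0 (by positivity) (by positivity)
      (mul_nonneg ((integral_nonneg fun t => abs_nonneg _).trans hddqL1) hd)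
      (fun t => (hM t).add (hasDerivAt_integral_shift_mul hq hdq_cont hqb hdqb hf₁m hf₁b t))
      (fun t => (hν t).add (hasDerivAt_integral_shift_mul hdq hddq_cont hdqb hddqb hf₁m hf₁b t))
      (hdν_cont.add (continuous_integral_shift_mul hddq_cont hddqb hf₁m hf₁b))
      (fun t => (hM t).add (hasDerivAt_integral_shift_mul hq hdq_cont hqb hdqb hf₂m hf₂b t))
      (fun t => (hν t).add (hasDerivAt_integral_shift_mul hdq hddq_cont hdqb hddqb hf₂m hf₂b t))
      (hdν_cont.add (continuous_integral_shift_mul hddq_cont hddqb hf₂m hf₂b))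
      (hlow hf₁b) (hlow hf₂b) (hdd hf₁b) (hdd hf₂b)
      (fun t => by
        rw [add_sub_add_left_eq_sub, integral_shift_mul_sub hq_cont hqb hf₁m hf₂m hf₁b hf₂b]
        exact hSq hdm t)
      (fun t => by
        rw [add_sub_add_left_eq_sub, integral_shift_mul_sub hdq_cont hdqb hf₁m hf₂m hf₁b hf₂b]
        exact hSdq hdm t)
      (fun t => by
        rw [add_sub_add_left_eq_sub, integral_shift_mul_sub hddq_cont hddqb hf₁m hf₂m hf₁b hf₂b]
        exact hSddq hdm t) u
    exact key.trans (contraction_numerics hQ₀ hQ₁ hQ₁1 hQ₂1 hL0 hd hc4)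
  -- Banach's fixed point theorem on the ball of radius `Q₀` of `ℝ →ᵇ ℝ`, and the exports
  obtain ⟨f, hf_cont, hfb, hfix⟩ := exists_fixedPoint_of_contraction hQ₀
    (fun (f : ℝ → ℝ) (u : ℝ) => ∫ s, q (u - s) * Int.fract (M s + ∫ r, q (s - r) * f r))
    hTc hTb hTl
  have hfm : AEStronglyMeasurable f := hf_cont.aestronglyMeasurable
  exact ⟨f, hf_cont, hfb, fun u => hfix u,
    fun u => hasDerivAt_integral_shift_mul hq hdq_cont hqb hdqb hfm hfb u,
    fun u => hasDerivAt_integral_shift_mul hdq hddq_cont hdqb hddqb hfm hfb u,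
    continuous_integral_shift_mul hddq_cont hddqb hfm hfb,
    fun u => hSdq hfb u, fun u => hSddq hfb u⟩

end Summit.RiemannHypothesis.RiemannHypothesis.Theorems.SpectralThesis.Sketch
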